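import Literature.NumberTheory.Automorphic.RankinSelbergTwistedUnfoldingRealPointPairs
import Literature.NumberTheory.Automorphic.RankinSelbergUnfoldingIdentity
import Literature.NumberTheory.Automorphic.RankinSelbergUnfoldedEulerCuspidalPairs
import Literature.NumberTheory.Automorphic.RankinSelbergTorusFinitenessSchwartz
import Literature.NumberTheory.Automorphic.PairLFunctionPolesEqConjLocalReduction
import HarnessLib

/-!
# The global half of Corollaire (i)(b) for pairs with `ω_π ω̄_σ ≠ 1`: `I_η(s)` is entire and equals
# `C · L^{S'}(s, π × π̄') · (local integral)` on `1 < Re s < 2`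

Topic `NumberTheory/Automorphic`; namespace `Literature.NumberTheory.Automorphic`. Proof file (theorems
only). The twisted companion of `PairLFunctionNeConjGlobalRankinSelberg` in the inline decomposition of the
named fact `MoeglinWaldspurger1989_partialPairL_entire_of_ne_conj` (Mœglin–Waldspurger (1989), Appendice,
Cor. (i)(b)): the pairs of cuspidal representations `π ∋ f`, `π' ∋ f'` whose central characters `ω`, `ω'`
differ are treated in print with the mirabolic Eisenstein series twisted by `η = ω ω'⁻¹ ≠ 1` (Cogdell
(2004), §2.3, p. 211), whose Rankin–Selberg integral `I_η(s) = ∫_X φ̄̃' φ̃ E_X(·, Φ; s, η)` is ENTIRE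
(`RankinSelbergIntegralTwistedEntire`; Jacquet–Shalika (1981), Lemma 4.2, Thm. 4.8) — no residues.

* `exists_rankinSelbergIntegralTwisted_star_eq_mul_rankinSelbergTorusPairIntegralC` — the unfolding on the
  strip `1 < Re s < 2`: `I_η(s; S̄_θ f', S_θ f, Φ) = C · Ψ(s; W_φ, W̄_{φ'}, Φ)` (the real-point identity
  `RankinSelbergTwistedUnfoldingRealPointPairs` and the identity theorem);
* `exists_entire_eq_partialPairL_mul_setIntegral_pair_twisted` (**main**) — an entire `F` with
  `F(s) = I_η(s)` for `re s > 1` and `F(s) = C · L^{S'}(s, π × π̄') · ∫_{B × K} W_φ W̄_{φ'} Φ(e_n ·) |det|^s δ_B⁻¹`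
  on the strip (Euler factorisation `RankinSelbergUnfoldedEulerCuspidalPairs`).

## References

* C. Mœglin, J.-L. Waldspurger, *Le spectre résiduel de GL(n)*, ASENS 22 (1989), Appendice,
  Corollaire (i)(b), p. 667 [MoeglinWaldspurger1989].
* J. W. Cogdell, *Analytic theory of L-functions for GL_n*, in *An Introduction to the Langlands
  Program* (2004), §2.3 Thm. 2.1–2.2 and p. 211, §4.2 [CogdellAnalyticTheory2004].
* H. Jacquet, J. A. Shalika, *On Euler products and the classification of automorphic
  representations I*, Amer. J. Math. 103 (1981), §4, Lemma 4.2, (4.4)–(4.6), Thm. 4.8 [JacquetShalikaAJM1981].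
-/

noncomputable section

open MeasureTheory Measure NumberField IsDedekindDomain Matrix Set Filter Topology
open scoped ENNReal NNReal ComplexConjugate

namespace Literature.NumberTheory.Automorphic

open Literature.NumberTheory.GaloisRepresentations (ideleGroup HeckeCharacter)

-- the automorphic quotient carries the tree's Borel σ-algebra, not Mathlib's quotient σ-algebra
-- (verbatim from `RankinSelbergUnfoldingIdentity`)
attribute [-instance] Quotient.instMeasurableSpace QuotientGroup.measurableSpace

section PairGlobalTwisted

open ValuativeRel

variable {n : ℕ} {K : Type} [Field K] [NumberField K]
variable [MeasurableSpace (AdeleRing (𝓞 K) K)] [BorelSpace (AdeleRing (𝓞 K) K)]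

-- the house local instances, exactly as in `RankinSelbergUnfoldingIdentity`
attribute [local instance] adelicBorel borelSpace_adelic locallyCompactSpace_adelic secondCountableTopology_gl_adelic
  glAdeleBorel borelSpace_glAdele borelSpace_ideleGroup secondCountableTopology_ideleGroup

/-- **The twisted unfolding identity for a pair on the strip `1 < Re s < 2`.** There is a constant
`C > 0`, depending only on the Haar measures, such that for all cuspidal automorphic representations
`π`, `π'` of `GL_n(𝔸_K)` (`0 < n`) whose smoothed forms transform under the centre through the unitary
characters `ω⁻¹`, `ω'⁻¹` with `η = ω ω'⁻¹ ≠ 1` trivial on `A_G`, all `f ∈ π`, `f' ∈ π'`, every test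
function `θ`, every real Schwartz–Bruhat `Φ ≥ 0` with `g ↦ Φ(e_n g)` measurable and every `s` with
`1 < Re s < 2`: `I_η(s; S̄_θ f', S_θ f, Φ) = C · Ψ(s; W_φ, W̄_{φ'}, Φ)`, i.e.
`rankinSelbergIntegralTwisted μ' ν_I hη₀ Φ s (star (S_θ f')) (S_θ f) = C · rankinSelbergTorusPairIntegralC νA νK W_φ (star W_{φ'}) Φ s`
(Cogdell (2004), Thm. 2.1 with p. 211; Jacquet–Shalika (1981), §4, (4.6)): both sides are holomorphic on
the strip (`differentiableOn_rankinSelbergIntegralTwisted_of_one_lt_re`, `RankinSelbergTorusHolomorphy`) and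
agree at its real points (`exists_rankinSelbergIntegralTwisted_ofReal_eq_mul_rankinSelbergTorusPairIntegral`).
[cite: CogdellAnalyticTheory2004, §2.3 Thm. 2.1] [cite: JacquetShalikaAJM1981, §4] -/
theorem exists_rankinSelbergIntegralTwisted_star_eq_mul_rankinSelbergTorusPairIntegralC (hn : 0 < n)
    (μ' : Measure (AdelicGroupData.gl n K).automorphicQuotient) [(AdelicGroupData.gl n K).IsAutomorphicMeasure μ']
    (νI : Measure (ideleGroup K)) [νI.IsHaarMeasure]
    (νA : Measure (Fin n → ideleGroup K)) [IsHaarMeasure νA]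
    (νK : Measure ↥(maximalCompactAdelic n K)) [IsHaarMeasure νK]
    (ν₀ : Measure ↥(adelicUnipotent n K)) [IsHaarMeasure ν₀] :
    ∃ C : ℝ, 0 < C ∧
      ∀ (P Q : CuspidalAutomorphicRepGL n K μ') (f : P.1.toSubmodule) (f' : Q.1.toSubmodule)
        {ω ω' η : HeckeCharacter K}, ω.IsUnitary → ω'.IsUnitary → η = ω * ω'⁻¹ → η ≠ 1 →
      ∀ (hη₀ : ∀ t : ℝ≥0ˣ, η (posRealIdele K t) = 1)
        {θ : (AdelicGroupData.gl n K).Adelic → ℝ}, IsTestFunctionGL n K θ →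
        (∀ (z : ideleGroup K) (g : GL (Fin n) (AdeleRing (𝓞 K) K)),
          smoothedForm θ (f : (AdelicGroupData.gl n K).L2 μ')
              ((AdelicGroupData.gl n K).toAutomorphicQuotient (Matrix.GeneralLinearGroup.scalar (Fin n) z * g)) =
            ((ω z : ℂˣ) : ℂ)⁻¹ * smoothedForm θ (f : (AdelicGroupData.gl n K).L2 μ')
              ((AdelicGroupData.gl n K).toAutomorphicQuotient g)) →
        (∀ (z : ideleGroup K) (g : GL (Fin n) (AdeleRing (𝓞 K) K)),
          smoothedForm θ (f' : (AdelicGroupData.gl n K).L2 μ')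
              ((AdelicGroupData.gl n K).toAutomorphicQuotient (Matrix.GeneralLinearGroup.scalar (Fin n) z * g)) =
            ((ω' z : ℂˣ) : ℂ)⁻¹ * smoothedForm θ (f' : (AdelicGroupData.gl n K).L2 μ')
              ((AdelicGroupData.gl n K).toAutomorphicQuotient g)) →
      ∀ {Φ : (Fin n → AdeleRing (𝓞 K) K) → ℝ}, (fun x => (Φ x : ℂ)) ∈ piSchwartzBruhat K (Fin n) →
        (∀ x, 0 ≤ Φ x) → (Measurable fun g : GL (Fin n) (AdeleRing (𝓞 K) K) => Φ (lastRow n K g)) →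
      ∀ {s : ℂ}, 1 < s.re → s.re < 2 →
        rankinSelbergIntegralTwisted μ' νI hη₀ (fun x => (Φ x : ℂ)) s
            (star (smoothedForm θ (f' : (AdelicGroupData.gl n K).L2 μ')))
            (smoothedForm θ (f : (AdelicGroupData.gl n K).L2 μ')) =
          (C : ℂ) * rankinSelbergTorusPairIntegralC n K νA νK
            (whittakerCoeff ν₀ (unipotentTateDomain n K) (adeleAddChar K)
              (invQuot (AdelicGroupData.gl n K) (smoothedForm θ (f : (AdelicGroupData.gl n K).L2 μ'))))
            (star (whittakerCoeff ν₀ (unipotentTateDomain n K) (adeleAddChar K)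
              (invQuot (AdelicGroupData.gl n K) (smoothedForm θ (f' : (AdelicGroupData.gl n K).L2 μ')))))
            Φ s := by
  classical
  haveI : T2Space (GL (Fin n) (AdeleRing (𝓞 K) K)) := t2Space_gl n K
  haveI : LocallyCompactSpace (GL (Fin n) (AdeleRing (𝓞 K) K)) :=
    AdelicGroupData.locallyCompactSpace_generalLinearGroup_adeleRing K (Fin n)
  haveI : SecondCountableTopology (GL (Fin n) (AdeleRing (𝓞 K) K)) :=
    secondCountableTopology_generalLinearGroup_adeleRing K (Fin n)
  haveI : SecondCountableTopology (AdelicGroupData.gl n K).Adelic :=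
    secondCountableTopology_generalLinearGroup_adeleRing K (Fin n)
  haveI : SecondCountableTopology ↥(maximalCompactAdelic n K) := TopologicalSpace.Subtype.secondCountableTopology _
  haveI hνIR : νI.IsMulRightInvariant := by
    haveI := isInvInvariant_of_isHaarMeasure_ideleGroup (K := K) νI
    infer_instance
  obtain ⟨C, hC0, hR⟩ :=
    exists_rankinSelbergIntegralTwisted_ofReal_eq_mul_rankinSelbergTorusPairIntegral (n := n) (K := K) hn μ' νI νA νK ν₀
  refine ⟨C, hC0, fun P Q f f' {ω ω' η} hωu hω'u hηeq hη1 hη₀ {θ} hθ hωf hω'f' {Φ} hΦS hΦ0 hΦm {s} hs1 hs2 => ?_⟩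
  -- the twisting character is unitary and non-trivial on `𝕀_K¹`
  have hηu : η.IsUnitary := by
    intro a
    rw [hηeq, HeckeCharacter.mul_apply, HeckeCharacter.inv_apply, Units.val_mul, Units.val_inv_eq_inv_val,
      norm_mul, norm_inv, hωu a, hω'u a, inv_one, mul_one]
  have hηb : ∃ b : ideleGroup K, IdeleClassGroup.ideleNorm K b = 1 ∧ η b ≠ 1 :=
    η.exists_ideleNorm_eq_one_and_ne_one_of_map_posRealIdele hη₀ hη1
  -- the datum
  set φt : (AdelicGroupData.gl n K).automorphicQuotient → ℂ :=
    smoothedForm θ (f : (AdelicGroupData.gl n K).L2 μ') with hφt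
  set φt' : (AdelicGroupData.gl n K).automorphicQuotient → ℂ :=
    smoothedForm θ (f' : (AdelicGroupData.gl n K).L2 μ') with hφt'
  set φ : GL (Fin n) (AdeleRing (𝓞 K) K) → ℂ := invQuot (AdelicGroupData.gl n K) φt with hφ
  set φ' : GL (Fin n) (AdeleRing (𝓞 K) K) → ℂ := invQuot (AdelicGroupData.gl n K) φt' with hφ'
  have hφtc : Continuous φt := continuous_smoothedForm hθ.continuous hθ.hasCompactSupport _
  have hφt'c : Continuous φt' := continuous_smoothedForm hθ.continuous hθ.hasCompactSupport _
  have hφc : Continuous φ := continuous_invQuot_smoothedForm hθ.continuous hθ.hasCompactSupport _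
  have hφ'c : Continuous φ' := continuous_invQuot_smoothedForm hθ.continuous hθ.hasCompactSupport _
  have hφd : IsRapidlyDecreasingGL n K φ := isRapidlyDecreasingGL_invQuot_smoothedForm hθ (P.2.1 f.2)
  have hφ'd : IsRapidlyDecreasingGL n K (invQuot (AdelicGroupData.gl n K) (star φt')) :=
    isRapidlyDecreasingGL_invQuot_star (isRapidlyDecreasingGL_invQuot_smoothedForm hθ (Q.2.1 f'.2))
  set W : GL (Fin n) (AdeleRing (𝓞 K) K) → ℂ :=
    whittakerCoeff ν₀ (unipotentTateDomain n K) (adeleAddChar K) φ with hW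
  set W' : GL (Fin n) (AdeleRing (𝓞 K) K) → ℂ :=
    whittakerCoeff ν₀ (unipotentTateDomain n K) (adeleAddChar K) φ' with hW'
  have hWc : Continuous W :=
    continuous_whittakerCoeff measurableSet_unipotentTateDomain isCompact_closure_unipotentTateDomain
      (continuous_adeleAddChar (K := K)) hφc
  have hW'c : Continuous W' :=
    continuous_whittakerCoeff measurableSet_unipotentTateDomain isCompact_closure_unipotentTateDomain
      (continuous_adeleAddChar (K := K)) hφ'c
  have hW'sc : Continuous (star W') := hW'c.star
  -- the two holomorphic functions
  set U : Set ℂ := {z : ℂ | 1 < z.re ∧ z.re < 2} with hU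
  have hUo : IsOpen U :=
    (isOpen_lt continuous_const Complex.continuous_re).inter (isOpen_lt Complex.continuous_re continuous_const)
  have hUc : IsPreconnected U := by
    have hUeq : U = Complex.reLm ⁻¹' Set.Ioo (1 : ℝ) 2 := by
      ext z
      simp only [hU, Set.mem_setOf_eq, Set.mem_preimage, Set.mem_Ioo, Complex.reLm_coe]
    rw [hUeq]
    exact ((convex_Ioo (1 : ℝ) 2).linear_preimage Complex.reLm).isPreconnected
  have hI : DifferentiableOn ℂ
      (fun z => rankinSelbergIntegralTwisted μ' νI hη₀ (fun x => (Φ x : ℂ)) z (star φt') φt) U :=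
    (differentiableOn_rankinSelbergIntegralTwisted_of_one_lt_re (K := K) νI hn μ' hηu hηb hη₀ hΦS
      (continuous_star.comp hφt'c) hφtc hφ'd hφd).mono fun z hz => hz.1
  have hpt : Measurable (torusPoint n K) := continuous_torusPoint.measurable
  have hm : ∀ z : ℂ, AEStronglyMeasurable (fun p : (Fin n → ideleGroup K) × ↥(maximalCompactAdelic n K) =>
      W (torusPoint n K p) * (star W') (torusPoint n K p) * (Φ (lastRow n K (torusPoint n K p)) : ℂ) *
        torusWeightC n K z p.1) (νA.prod νK) := fun z =>
    (measurable_torusPairIntegrandC (hWc.measurable.comp hpt) (hW'sc.measurable.comp hpt) (hΦm.comp hpt) z).aestronglyMeasurable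
  have hmr : ∀ σ : ℝ, Measurable (torusIntegrand n K W Φ σ) := fun σ => measurable_torusIntegrand hWc hΦm σ
  have hmr' : ∀ σ : ℝ, Measurable (torusIntegrand n K (star W') Φ σ) := fun σ => measurable_torusIntegrand hW'sc hΦm σ
  have hfin : ∀ σ : ℝ, 1 < σ → rankinSelbergTorusIntegral n K νA νK W Φ σ ≠ ⊤ := fun σ hσ =>
    rankinSelbergTorusIntegral_whittakerCoeff_ne_top_of_mem_piSchwartzBruhat hn νA νK ν₀ P f hθ hΦS hΦ0 hΦm hσ
  have hfin₂ : ∀ σ : ℝ, 1 < σ → rankinSelbergTorusIntegral n K νA νK W' Φ σ ≠ ⊤ := fun σ hσ =>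
    rankinSelbergTorusIntegral_whittakerCoeff_ne_top_of_mem_piSchwartzBruhat hn νA νK ν₀ Q f' hθ hΦS hΦ0 hΦm hσ
  have hfin' : ∀ σ : ℝ, 1 < σ → rankinSelbergTorusIntegral n K νA νK (star W') Φ σ ≠ ⊤ := fun σ hσ => by
    rw [rankinSelbergTorusIntegral_star]; exact hfin₂ σ hσ
  have hG : DifferentiableOn ℂ (fun z => (C : ℂ) * rankinSelbergTorusPairIntegralC n K νA νK W (star W') Φ z) U := by
    have h := differentiableOn_setIntegral_mul_mul_torusWeightC (σ₁ := 1) (σ₂ := 2) νA νK hΦ0 hm hmr hmr'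
      (fun σ hσ₁ _ => hfin σ hσ₁) (fun σ hσ₁ _ => hfin' σ hσ₁) Set.univ
    simp_rw [Measure.restrict_univ] at h
    exact h.const_mul _
  -- equality at the real points of the strip
  have hreal : ∀ σ : ℝ, 1 < σ → σ < 2 →
      rankinSelbergIntegralTwisted μ' νI hη₀ (fun x => (Φ x : ℂ)) (σ : ℂ) (star φt') φt =
        (C : ℂ) * rankinSelbergTorusPairIntegralC n K νA νK W (star W') Φ (σ : ℂ) := by
    intro σ hσ1 _
    rw [hR P Q f f' hωu hω'u hηeq hη₀ hθ.continuous hθ.hasCompactSupport hωf hω'f' hΦS hΦ0 hΦm hσ1 (hfin σ hσ1)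
      (hfin₂ σ hσ1), rankinSelbergTorusPairIntegral_eq_rankinSelbergTorusPairIntegralC]
  -- the identity theorem
  have hEq := (hI.analyticOnNhd hUo).eqOn_of_preconnected_of_mem_closure (hG.analyticOnNhd hUo) hUc
    (z₀ := ((3 / 2 : ℝ) : ℂ)) (by simp only [hU, Set.mem_setOf_eq, Complex.ofReal_re]; norm_num)
    (three_halves_mem_closure_real_strip fun σ hσ1 hσ2 => hreal σ hσ1 hσ2)
  exact hEq ⟨hs1, hs2⟩

/-- **The global half of Mœglin–Waldspurger's Corollaire (i)(b) for pairs with `ω_π ω_{π'}⁻¹ ≠ 1`.** There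
is a constant `C > 0`, depending only on the Haar measures, such that for all cuspidal automorphic
representations `π`, `π'` of `GL_n(𝔸_K)` (`0 < n`) with Satake families `α`, `γ` off `S`, whose smoothed
forms transform under the centre through unitary `ω⁻¹`, `ω'⁻¹` with `η = ω ω'⁻¹ ≠ 1` trivial on `A_G`, all
`f ∈ π`, `f' ∈ π'`, every ideal `𝔫₀ ≠ 0` and test function `θ` left invariant under `K(𝔫₀)`, every set of
finite places `S' ⊇ S` off which `v ∤ 𝔫₀` and `v ∤ 𝔡_{K/ℚ}`, all enumerations `x`, `y` of `α`, `γ` off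
`S'`, and every standard test function `Φ = Φ_∞ ⊗ 𝟙_{𝒪̂ⁿ}` with `Φ_∞ ≥ 0` continuous and `Φ`
Schwartz–Bruhat, there is an **entire** function `F` with

* `F(s) = I_η(s; S̄_θ f', S_θ f, Φ)` for `re s > 1` (`exists_entire_eq_rankinSelbergIntegralTwisted`: the
  twisted Eisenstein series has no poles, Jacquet–Shalika (1981), Lemma 4.2);
* `F(s) = C · partialPairL S' α γ̄ s · ∫_{B({v ∉ S'}) × K} W_φ W̄_{φ'} Φ(e_n ·) |det|^s δ_B⁻¹` for
  `1 < re s < 2` — unfolding on the strip and the Euler factorisation of the pair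
  (`RankinSelbergUnfoldedEulerCuspidalPairs`) for Tate's character (conductor `𝒪_v` off `𝔡`).

Cogdell (2004), Thm. 2.1–2.2 with §2.3 p. 211; Jacquet–Shalika (1981), §4; with `π' = σ̄` this is the
global Rankin–Selberg input of Mœglin–Waldspurger (1989), Appendice, Cor. (i)(b) for `ω_π ω̄_σ ≠ 1`.
[cite: MoeglinWaldspurger1989, Appendice, Corollaire (i)(b)] [cite: CogdellAnalyticTheory2004, §2.3 Thm. 2.2, p. 211] -/
theorem exists_entire_eq_partialPairL_mul_setIntegral_pair_twisted (hn : 0 < n)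
    (μ' : Measure (AdelicGroupData.gl n K).automorphicQuotient) [(AdelicGroupData.gl n K).IsAutomorphicMeasure μ']
    (νI : Measure (ideleGroup K)) [νI.IsHaarMeasure]
    (νA : Measure (Fin n → ideleGroup K)) [IsHaarMeasure νA]
    (νK : Measure ↥(maximalCompactAdelic n K)) [IsHaarMeasure νK]
    (ν₀ : Measure ↥(adelicUnipotent n K)) [IsHaarMeasure ν₀] :
    ∃ C : ℝ, 0 < C ∧
      ∀ (P Q : CuspidalAutomorphicRepGL n K μ') (f : P.1.toSubmodule) (f' : Q.1.toSubmodule)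
        {ω ω' η : HeckeCharacter K}, ω.IsUnitary → ω'.IsUnitary → η = ω * ω'⁻¹ → η ≠ 1 →
      ∀ (hη₀ : ∀ t : ℝ≥0ˣ, η (posRealIdele K t) = 1)
        {S : Set (HeightOneSpectrum (𝓞 K))} {α γ : SatakeFamily K}, IsSatakeFamilyOf P S α →
        IsSatakeFamilyOf Q S γ →
      ∀ {𝔫₀ : Ideal (𝓞 K)}, 𝔫₀ ≠ 0 →
      ∀ {θ : (AdelicGroupData.gl n K).Adelic → ℝ}, IsTestFunctionGL n K θ →
        (∀ k : (AdelicGroupData.gl n K).Adelic, k ∈ principalCongruenceLevel n K 𝔫₀ →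
          ∀ g : (AdelicGroupData.gl n K).Adelic, θ (k * g) = θ g) →
        (∀ (z : ideleGroup K) (g : GL (Fin n) (AdeleRing (𝓞 K) K)),
          smoothedForm θ (f : (AdelicGroupData.gl n K).L2 μ')
              ((AdelicGroupData.gl n K).toAutomorphicQuotient (Matrix.GeneralLinearGroup.scalar (Fin n) z * g)) =
            ((ω z : ℂˣ) : ℂ)⁻¹ * smoothedForm θ (f : (AdelicGroupData.gl n K).L2 μ')
              ((AdelicGroupData.gl n K).toAutomorphicQuotient g)) →
        (∀ (z : ideleGroup K) (g : GL (Fin n) (AdeleRing (𝓞 K) K)),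
          smoothedForm θ (f' : (AdelicGroupData.gl n K).L2 μ')
              ((AdelicGroupData.gl n K).toAutomorphicQuotient (Matrix.GeneralLinearGroup.scalar (Fin n) z * g)) =
            ((ω' z : ℂˣ) : ℂ)⁻¹ * smoothedForm θ (f' : (AdelicGroupData.gl n K).L2 μ')
              ((AdelicGroupData.gl n K).toAutomorphicQuotient g)) →
      ∀ {S' : Set (HeightOneSpectrum (𝓞 K))}, S ⊆ S' →
        (∀ v ∉ S', ¬ v.asIdeal ∣ 𝔫₀ ∧ ¬ v.asIdeal ∣ differentIdeal ℤ (𝓞 K)) →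
      ∀ {x y : HeightOneSpectrum (𝓞 K) → Fin n → ℂ},
        (∀ v ∉ S', (Finset.univ : Finset (Fin n)).val.map (x v) = α v) →
        (∀ v ∉ S', (Finset.univ : Finset (Fin n)).val.map (y v) = γ v) →
      ∀ {Φinf : (Fin n → InfiniteAdeleRing K) → ℝ}, Continuous Φinf → (∀ z, 0 ≤ Φinf z) →
        (fun v => ((standardTestFun n K Φinf v : ℝ) : ℂ)) ∈ piSchwartzBruhat K (Fin n) →
      ∃ F : ℂ → ℂ, Differentiable ℂ F ∧
        (∀ s : ℂ, 1 < s.re → F s =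
          rankinSelbergIntegralTwisted μ' νI hη₀ (fun v => ((standardTestFun n K Φinf v : ℝ) : ℂ)) s
            (star (smoothedForm θ (f' : (AdelicGroupData.gl n K).L2 μ')))
            (smoothedForm θ (f : (AdelicGroupData.gl n K).L2 μ'))) ∧
        (∀ s : ℂ, 1 < s.re → s.re < 2 → F s = (C : ℂ) *
          (partialPairL S' α (fun v => (γ v).map conj) s *
            ∫ p in unitBox {v | v ∉ S'} ×ˢ Set.univ, torusPairIntegrandC n K
              (whittakerCoeff ν₀ (unipotentTateDomain n K) (adeleAddChar K)
                (invQuot (AdelicGroupData.gl n K) (smoothedForm θ (f : (AdelicGroupData.gl n K).L2 μ'))))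
              (star (whittakerCoeff ν₀ (unipotentTateDomain n K) (adeleAddChar K)
                (invQuot (AdelicGroupData.gl n K) (smoothedForm θ (f' : (AdelicGroupData.gl n K).L2 μ')))))
              (standardTestFun n K Φinf) s p ∂(νA.prod νK))) := by
  classical
  haveI : T2Space (GL (Fin n) (AdeleRing (𝓞 K) K)) := t2Space_gl n K
  haveI : LocallyCompactSpace (GL (Fin n) (AdeleRing (𝓞 K) K)) :=
    AdelicGroupData.locallyCompactSpace_generalLinearGroup_adeleRing K (Fin n)
  haveI : SecondCountableTopology (GL (Fin n) (AdeleRing (𝓞 K) K)) :=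
    secondCountableTopology_generalLinearGroup_adeleRing K (Fin n)
  haveI hν₀R : ν₀.IsMulRightInvariant := isMulRightInvariant_of_isHaarMeasure_adelicUnipotent ν₀
  haveI hνIR : νI.IsMulRightInvariant := by
    haveI := isInvInvariant_of_isHaarMeasure_ideleGroup (K := K) νI
    infer_instance
  haveI := locallyCompactSpace_ideleGroup K
  haveI : CompactSpace ↥(maximalCompactAdelic n K) :=
    isCompact_iff_compactSpace.1 (isCompact_maximalCompactAdelic n K)
  obtain ⟨C, hC, hunf⟩ :=
    exists_rankinSelbergIntegralTwisted_star_eq_mul_rankinSelbergTorusPairIntegralC (n := n) (K := K) hn μ' νI νA νK ν₀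
  refine ⟨C, hC, fun P Q f f' {ω ω' η} hωu hω'u hηeq hη1 hη₀ {S} {α} {γ} hα hγ {𝔫₀} h𝔫₀ {θ} hθ hθK hωf hω'f'
    {S'} hSS' hS' {x} {y} hx hy {Φinf} hΦic hΦi0 hΦS => ?_⟩
  -- the test function
  set Φ : (Fin n → AdeleRing (𝓞 K) K) → ℝ := standardTestFun n K Φinf with hΦdef
  have hΦ0 : ∀ v, 0 ≤ Φ v := standardTestFun_nonneg hΦi0
  have hΦc : Continuous Φ := continuous_standardTestFun_of_continuous n K hΦic
  have hΦm : Measurable fun g : GL (Fin n) (AdeleRing (𝓞 K) K) => Φ (lastRow n K g) :=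
    (hΦc.comp continuous_lastRow).measurable
  -- the twisting character is unitary and non-trivial on `𝕀_K¹`
  have hηu : η.IsUnitary := by
    intro a
    rw [hηeq, HeckeCharacter.mul_apply, HeckeCharacter.inv_apply, Units.val_mul, Units.val_inv_eq_inv_val,
      norm_mul, norm_inv, hωu a, hω'u a, inv_one, mul_one]
  have hηb : ∃ b : ideleGroup K, IdeleClassGroup.ideleNorm K b = 1 ∧ η b ≠ 1 :=
    η.exists_ideleNorm_eq_one_and_ne_one_of_map_posRealIdele hη₀ hη1
  -- the entire continuation of `I_η`
  have hφtc : Continuous (smoothedForm θ (f : (AdelicGroupData.gl n K).L2 μ')) :=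
    continuous_smoothedForm hθ.continuous hθ.hasCompactSupport _
  have hφt'c : Continuous (smoothedForm θ (f' : (AdelicGroupData.gl n K).L2 μ')) :=
    continuous_smoothedForm hθ.continuous hθ.hasCompactSupport _
  have hφd : IsRapidlyDecreasingGL n K (invQuot (AdelicGroupData.gl n K) (smoothedForm θ (f : (AdelicGroupData.gl n K).L2 μ'))) :=
    isRapidlyDecreasingGL_invQuot_smoothedForm hθ (P.2.1 f.2)
  have hφ'd : IsRapidlyDecreasingGL n K (invQuot (AdelicGroupData.gl n K)
      (star (smoothedForm θ (f' : (AdelicGroupData.gl n K).L2 μ')))) :=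
    isRapidlyDecreasingGL_invQuot_star (isRapidlyDecreasingGL_invQuot_smoothedForm hθ (Q.2.1 f'.2))
  obtain ⟨F, hF, hFI⟩ := exists_entire_eq_rankinSelbergIntegralTwisted (K := K) νI hn μ' hηu hηb hη₀ hΦS
    (show Continuous (star (smoothedForm θ (f' : (AdelicGroupData.gl n K).L2 μ'))) from continuous_star.comp hφt'c)
    hφtc hφ'd hφd
  refine ⟨F, hF, hFI, fun s hs1 hs2 => ?_⟩
  -- Tate's character and fundamental domain
  have hψ : IsGlobalAddChar K (adeleAddChar K) := isGlobalAddChar_adeleAddChar (K := K)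
  have h𝓕 : IsFundamentalDomain ↥(rationalUnipotent n K) (unipotentTateDomain n K) ν₀ :=
    isFundamentalDomain_unipotentTateDomain ν₀
  have h𝓕c : IsCompact (closure (unipotentTateDomain n K)) := isCompact_closure_unipotentTateDomain
  have h𝓕m : MeasurableSet (unipotentTateDomain n K) := measurableSet_unipotentTateDomain
  have hGood : ∀ v ∉ S', ¬ v.asIdeal ∣ 𝔫₀ ∧
      (∀ c ∈ 𝒪[v.adicCompletion K], (adeleAddChar K).adicComponent v c = 1) ∧
      ∀ ϖ : v.adicCompletion K, Valued.v ϖ = WithZero.exp (-1 : ℤ) →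
        ∃ c ∈ 𝒪[v.adicCompletion K], (adeleAddChar K).adicComponent v (ϖ⁻¹ * c) ≠ 1 := fun v hv =>
    ⟨(hS' v hv).1, (adicComponent_adeleAddChar_unramified (K := K) (hS' v hv).2).1,
      (adicComponent_adeleAddChar_unramified (K := K) (hS' v hv).2).2⟩
  -- finiteness of the two real unfolded integrals at `re s`
  have hfin : rankinSelbergTorusIntegral n K νA νK
      (whittakerCoeff ν₀ (unipotentTateDomain n K) (adeleAddChar K)
        (invQuot (AdelicGroupData.gl n K) (smoothedForm θ (f : (AdelicGroupData.gl n K).L2 μ')))) Φ s.re ≠ ⊤ :=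
    rankinSelbergTorusIntegral_whittakerCoeff_ne_top_of_mem_piSchwartzBruhat hn νA νK ν₀ P f hθ hΦS hΦ0 hΦm hs1
  have hfin' : rankinSelbergTorusIntegral n K νA νK
      (whittakerCoeff ν₀ (unipotentTateDomain n K) (adeleAddChar K)
        (invQuot (AdelicGroupData.gl n K) (smoothedForm θ (f' : (AdelicGroupData.gl n K).L2 μ')))) Φ s.re ≠ ⊤ :=
    rankinSelbergTorusIntegral_whittakerCoeff_ne_top_of_mem_piSchwartzBruhat hn νA νK ν₀ Q f' hθ hΦS hΦ0 hΦm hs1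
  -- unfold on the strip and factor
  rw [hFI s hs1, hunf P Q f f' hωu hω'u hηeq hη1 hη₀ hθ hωf hω'f' hΦS hΦ0 hΦm hs1 hs2,
    rankinSelbergTorusPairIntegralC_whittakerCoeff_eq_partialPairL_mul hn P Q hα hγ h𝔫₀ hθ.continuous
      hθ.hasCompactSupport hθK f f' h𝓕 h𝓕m h𝓕c hψ hSS' hGood hx hy hΦi0 hΦm νA νK hs1 hfin hfin']

end PairGlobalTwisted

end Literature.NumberTheory.Automorphic
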